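import Summits.QuantumFields.YangMills.Theorems.UnitScaleTiltProp7CornerCombLevelInduction
import HarnessLib

/-!
# Route `UnitScaleTilt`, crux K1 «MinimiserStabilityRegPr» (stmt-QuantumFields-19200), route-R (β) (n3)-comb lane (II), ★routeR-w1 g9 PENS ROUND 4 file F-7c-2 —
# THE COUPLED CLOSURE (PURE REALS): the rem-sourced line `n_{j+1} ≤ (ρ + κ′_j)·n_j + σ_j·(m_j + n_j + λ_j)` whose source reads the FULL level field
# `ỹ_j ≤ m_j + n_j + λ_j` — and whose gauge part `λ_j` feeds back the lower `n_i` (`i < j`) with growing weights — closes by strong induction as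
# `n_j ≤ Qn·(ρ⁻¹)^j` with `Qn = 2E′θ₂·((M + c_A)·ρ^{2k₀+1}∕(1−ρ²) + c_B⁰·ρ³∕(1−ρ⁴))`, once `E′θ₂·(1 + c_B¹)·ρ³∕(1−ρ⁴) ≤ ½`

Cell `ym3-torus`, width seat `ym-ust-19200-w5` (gen 8); sequel of ✓p711108 `…CornerCombLevelInduction` (F-7c-1).  THEOREMS ONLY (0 `def`, 0 `sorry`);
`--supports stmt-QuantumFields-19200 --as helper`, count-neutral.  Pure real sequences.  YM₃ on T³ is a ladder rung (R3), not the Clay problem; nothing here claims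
`hMcomb`, `hMcomb₂`, (β), the stub, the crux, d = 4 or the mass gap.

WHY (★routeR-w4 F-7b-1 ∕ ★routeR-w6 F-6d-3 ∕ ★routeR-w1 F-7a).  After the split `G̃ = G̃^{lin} + N` (F-7c-1's ‼, adopted), the sourceless lines are closed by F-7c-1 §2∕§6
(`m_j ≤ M·ρ^j`, `g_j ≤ (ρ⁻¹)^j·g₀ + …`).  The `N`-line's source is `σ_j·ỹ_j` with `σ_j ≤ θ₂·ρ^{2(k₀−j)}` (the two-block sup) and `ỹ_j = √MASScell(Ỹ_j) ≤ m_j + n_j + λ_j`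
(`Ỹ_j = G̃^{lin}_j + N_j + ∇^{Ū}Λ_j`, Minkowski), where `λ_j = √MASScell(∇Λ_j)` is F-6d-3's output: a weighted sum over the LOWER levels `i < j` reading `n_i` again.  So `n`
feeds back twice (through `ỹ_j ∋ n_j` and through `λ_j ∋ n_i`), and the closure is a fixed-point bound proved by STRONG induction.  This file isolates the scalar fixed point:
the λ-feedback enters as ONE displayed implication `hfb` («if `n_i ≤ Q·(ρ⁻¹)^i` below level `j`, then `λ_j ≤ (c_B⁰ + c_B¹·Q)·(ρ⁻¹)^j + c_A·ρ^j`», AFFINE in `Q`) — its three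
constants are evaluated from F-6d-3's weights in F-7c-3 — and the conclusion is the pure B-shape `n_j ≤ Qn·(ρ⁻¹)^j` whose coefficient carries `ρ^{2k₀+1}` in front of the
mass `M` (so `n_j² ≤ …·M²·ρ^{4k₀+2}·(ρ⁻²)^j ≤ …·M₀·ρ^{2j}` for `j ≤ k₀`: A-slot) and `θ₂·ρ³` in front of the gauge datum `c_B⁰` (B-slot, small).

WHAT IS PROVED (ns `…Theorems.Prop7CornerCombCoupledClosure`).
* §1 `inv_pow_eq_inv_pow_mul_pow` (`(ρ⁻¹)^i = (ρ⁻¹)^j·ρ^{j−i}`, `i ≤ j`), `source_A_term_eq` ∕ `source_B_term_eq` (the two exponent identities of the fed source, `i < j ≤ k₀`),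
  `sum_source_A_le` (`Σ_{i<j} ρ^{j−1−i}·ρ^{2(k₀−i)}·ρ^i ≤ (ρ⁻¹)^j·ρ^{2k₀+1}∕(1−ρ²)`), `sum_source_B_le` (`Σ_{i<j} ρ^{j−1−i}·ρ^{2(k₀−i)}·(ρ⁻¹)^i ≤ (ρ⁻¹)^j·ρ³∕(1−ρ⁴)`), `j ≤ k₀`.
* §2 ★★★ `n_closure` — the title.
HONEST SCOPE.  Elementary real analysis (strong induction + two geometric sums); the constants `M c_A c_B⁰ c_B¹ θ₂ θ′` are whatever F-7b∕F-6d-3∕F-7c-3 make them.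
[folklore] bookkeeping behind [Balaban1985Averaging] Prop. 3 (122)–(126) p.36 and [Balaban1984PropagatorsI] (1.18)–(1.20) pp.19–20.
-/

set_option autoImplicit false

noncomputable section

open scoped BigOperators

namespace Summit.QuantumFields.YangMills.Theorems.Prop7CornerCombCoupledClosure

open Summit.QuantumFields.YangMills.Theorems.Prop7TrueLinSourcedDefectL1Rows (sourced_recursion_bound_init)
open Summit.QuantumFields.YangMills.Theorems.Prop7CornerCombLevelInduction (geom_sum_top_le)

/-! ## §1 Exponent bookkeeping of the fed source -/

/-- `(ρ⁻¹)^i = (ρ⁻¹)^j·ρ^{j−i}` for `i ≤ j` (`ρ ≠ 0`). [folklore] -/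
theorem inv_pow_eq_inv_pow_mul_pow {ρ : ℝ} (hρ : ρ ≠ 0) {i j : ℕ} (hij : i ≤ j) : (ρ⁻¹) ^ i = (ρ⁻¹) ^ j * ρ ^ (j - i) := by
  obtain ⟨t, rfl⟩ := Nat.exists_eq_add_of_le hij
  rw [Nat.add_sub_cancel_left, pow_add, mul_assoc, ← mul_pow, inv_mul_cancel₀ hρ, one_pow, mul_one]

/-- The A-shaped part of the fed source: `ρ^{j−1−i}·ρ^{2(k₀−i)}·ρ^i = (ρ⁻¹)^j·(ρ^{2k₀+1}·(ρ²)^{j−1−i})` (`i < j`). [folklore] -/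
theorem source_A_term_eq {ρ : ℝ} (hρ : ρ ≠ 0) {i j k₀ : ℕ} (hij : i < j) (hjk : j ≤ k₀) :
    ρ ^ (j - 1 - i) * ρ ^ (2 * (k₀ - i)) * ρ ^ i = (ρ⁻¹) ^ j * (ρ ^ (2 * k₀ + 1) * (ρ ^ 2) ^ (j - 1 - i)) := by
  rw [inv_pow, eq_inv_mul_iff_mul_eq₀ (pow_ne_zero _ hρ), ← pow_mul, ← pow_add, ← pow_add, ← pow_add, ← pow_add]
  congr 1; omega

/-- The B-shaped part of the fed source: `ρ^{j−1−i}·ρ^{2(k₀−i)}·(ρ⁻¹)^i = (ρ⁻¹)^j·(ρ^{2(k₀−j)+3}·(ρ⁴)^{j−1−i})` (`i < j ≤ k₀`). [folklore] -/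
theorem source_B_term_eq {ρ : ℝ} (hρ : ρ ≠ 0) {i j k₀ : ℕ} (hij : i < j) (hjk : j ≤ k₀) :
    ρ ^ (j - 1 - i) * ρ ^ (2 * (k₀ - i)) * (ρ⁻¹) ^ i = (ρ⁻¹) ^ j * (ρ ^ (2 * (k₀ - j) + 3) * (ρ ^ 4) ^ (j - 1 - i)) := by
  rw [inv_pow_eq_inv_pow_mul_pow hρ hij.le, inv_pow, ← mul_assoc, eq_inv_mul_iff_mul_eq₀ (pow_ne_zero _ hρ)]
  rw [show ρ ^ j * (ρ ^ (j - 1 - i) * ρ ^ (2 * (k₀ - i)) * (ρ ^ j)⁻¹ * ρ ^ (j - i)) = (ρ ^ j * (ρ ^ j)⁻¹) * (ρ ^ (j - 1 - i) * ρ ^ (2 * (k₀ - i)) * ρ ^ (j - i)) by ring,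
    mul_inv_cancel₀ (pow_ne_zero _ hρ), one_mul, ← pow_mul, ← pow_add, ← pow_add, ← pow_add]
  congr 1; omega

/-- `Σ_{i<j} ρ^{j−1−i}·ρ^{2(k₀−i)}·ρ^i ≤ (ρ⁻¹)^j·(ρ^{2k₀+1}∕(1−ρ²))` (`0 < ρ < 1`, `j ≤ k₀`). [folklore] -/
theorem sum_source_A_le {ρ : ℝ} (hρ0 : 0 < ρ) (hρ1 : ρ < 1) {j k₀ : ℕ} (hjk : j ≤ k₀) :
    ∑ i ∈ Finset.range j, ρ ^ (j - 1 - i) * ρ ^ (2 * (k₀ - i)) * ρ ^ i ≤ (ρ⁻¹) ^ j * (ρ ^ (2 * k₀ + 1) / (1 - ρ ^ 2)) := by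
  have hρ2 : ρ ^ 2 < 1 := pow_lt_one₀ hρ0.le hρ1 (by norm_num)
  have h12 : 0 < 1 - ρ ^ 2 := by linarith
  rw [Finset.sum_congr rfl fun i hi => source_A_term_eq hρ0.ne' (Finset.mem_range.mp hi) hjk, ← Finset.mul_sum, ← Finset.mul_sum,
    Finset.sum_range_reflect (fun t => (ρ ^ 2) ^ t) j]
  have hgeom : ∑ t ∈ Finset.range j, (ρ ^ 2) ^ t ≤ 1 / (1 - ρ ^ 2) := by
    rw [le_div_iff₀ h12, geom_sum_mul_neg (ρ ^ 2) j]
    have : 0 ≤ (ρ ^ 2) ^ j := pow_nonneg (sq_nonneg ρ) j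
    linarith
  have h0 : 0 ≤ (ρ⁻¹) ^ j * ρ ^ (2 * k₀ + 1) := by positivity
  calc (ρ⁻¹) ^ j * (ρ ^ (2 * k₀ + 1) * ∑ t ∈ Finset.range j, (ρ ^ 2) ^ t)
      = ((ρ⁻¹) ^ j * ρ ^ (2 * k₀ + 1)) * ∑ t ∈ Finset.range j, (ρ ^ 2) ^ t := by ring
    _ ≤ ((ρ⁻¹) ^ j * ρ ^ (2 * k₀ + 1)) * (1 / (1 - ρ ^ 2)) := mul_le_mul_of_nonneg_left hgeom h0
    _ = _ := by ring

/-- `Σ_{i<j} ρ^{j−1−i}·ρ^{2(k₀−i)}·(ρ⁻¹)^i ≤ (ρ⁻¹)^j·(ρ³∕(1−ρ⁴))` (`0 < ρ < 1`, `j ≤ k₀`; the extra `ρ^{2(k₀−j)} ≤ 1` is spent). [folklore] -/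
theorem sum_source_B_le {ρ : ℝ} (hρ0 : 0 < ρ) (hρ1 : ρ < 1) {j k₀ : ℕ} (hjk : j ≤ k₀) :
    ∑ i ∈ Finset.range j, ρ ^ (j - 1 - i) * ρ ^ (2 * (k₀ - i)) * (ρ⁻¹) ^ i ≤ (ρ⁻¹) ^ j * (ρ ^ 3 / (1 - ρ ^ 4)) := by
  have hρ4 : ρ ^ 4 < 1 := pow_lt_one₀ hρ0.le hρ1 (by norm_num)
  have h14 : 0 < 1 - ρ ^ 4 := by linarith
  rw [Finset.sum_congr rfl fun i hi => source_B_term_eq hρ0.ne' (Finset.mem_range.mp hi) hjk, ← Finset.mul_sum, ← Finset.mul_sum,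
    Finset.sum_range_reflect (fun t => (ρ ^ 4) ^ t) j]
  have hgeom : ∑ t ∈ Finset.range j, (ρ ^ 4) ^ t ≤ 1 / (1 - ρ ^ 4) := by
    rw [le_div_iff₀ h14, geom_sum_mul_neg (ρ ^ 4) j]
    have : 0 ≤ (ρ ^ 4) ^ j := pow_nonneg (pow_nonneg hρ0.le 4) j
    linarith
  have hρ3 : ρ ^ (2 * (k₀ - j) + 3) ≤ ρ ^ 3 := pow_le_pow_of_le_one hρ0.le hρ1.le (by omega)
  have h0 : 0 ≤ (ρ⁻¹) ^ j := pow_nonneg (inv_nonneg.mpr hρ0.le) _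
  have hs0 : 0 ≤ ∑ t ∈ Finset.range j, (ρ ^ 4) ^ t := Finset.sum_nonneg fun t _ => pow_nonneg (pow_nonneg hρ0.le 4) t
  calc (ρ⁻¹) ^ j * (ρ ^ (2 * (k₀ - j) + 3) * ∑ t ∈ Finset.range j, (ρ ^ 4) ^ t)
      ≤ (ρ⁻¹) ^ j * (ρ ^ 3 * (1 / (1 - ρ ^ 4))) :=
        mul_le_mul_of_nonneg_left (mul_le_mul hρ3 hgeom hs0 (pow_nonneg hρ0.le 3)) h0
    _ = _ := by ring

/-! ## §2 ★★★ The scalar fixed point -/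

/-- ★★★ **THE COUPLED CLOSURE.**  Reals `0 < ρ < 1`, `θ′ θ₂ M c_A c_B⁰ c_B¹ ≥ 0`; nonnegative sequences `κ′ σ n m lam`; top level `k₀`.  HYPOTHESES: `κ′ j ≤ θ′·ρ^{4(k₀−j)}` and
`σ j ≤ θ₂·ρ^{2(k₀−j)}` (`j < k₀`); the sourceless mass line `m j ≤ M·ρ^j` (`j ≤ k₀`, F-7c-1 §2); the rem-sourced line `n 0 = 0`,
`n (j+1) ≤ (ρ + κ′ j)·n j + σ j·(m j + n j + lam j)` (`j < k₀`); THE GAUGE FEEDBACK `hfb`: for every `Q ≥ 0` and `j ≤ k₀`, if `n i ≤ Q·(ρ⁻¹)^i` for all `i < j` then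
`lam j ≤ (c_B⁰ + c_B¹·Q)·(ρ⁻¹)^j + c_A·ρ^j` (F-7c-3 evaluates the three constants from F-6d-3's weighted rows); SMALLNESS `exp(θ′ρ³∕(1−ρ⁴))·θ₂·(1 + c_B¹)·(ρ³∕(1−ρ⁴)) ≤ ½`.
CONCLUSION: for every `j ≤ k₀`, `n j ≤ Qn·(ρ⁻¹)^j` with `Qn = 2·exp(θ′ρ³∕(1−ρ⁴))·θ₂·((M + c_A)·(ρ^{2k₀+1}∕(1−ρ²)) + c_B⁰·(ρ³∕(1−ρ⁴)))` — strong induction: unroll the line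
(✓`sourced_recursion_bound_init`), feed the source with the hypotheses below `j`, sum the two geometric series of §1, absorb the `Qn`-proportional part by the smallness. [folklore] -/
theorem n_closure {ρ θ' θ₂ M cA cB0 cB1 : ℝ} (hρ0 : 0 < ρ) (hρ1 : ρ < 1) (hθ' : 0 ≤ θ') (hθ₂ : 0 ≤ θ₂) (hM : 0 ≤ M) (hcA : 0 ≤ cA)
    (hcB0 : 0 ≤ cB0) (hcB1 : 0 ≤ cB1) (κ' σ n m lam : ℕ → ℝ) (hκ' : ∀ j, 0 ≤ κ' j) (hσ : ∀ j, 0 ≤ σ j) (hn : ∀ j, 0 ≤ n j)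
    (hm0 : ∀ j, 0 ≤ m j) (hlam : ∀ j, 0 ≤ lam j) {k₀ : ℕ}
    (hκ'geo : ∀ j < k₀, κ' j ≤ θ' * ρ ^ (4 * (k₀ - j))) (hσgeo : ∀ j < k₀, σ j ≤ θ₂ * ρ ^ (2 * (k₀ - j)))
    (hm : ∀ j ≤ k₀, m j ≤ M * ρ ^ j) (hn0 : n 0 = 0)
    (hrec : ∀ j < k₀, n (j + 1) ≤ (ρ + κ' j) * n j + σ j * (m j + n j + lam j))
    (hfb : ∀ Q : ℝ, 0 ≤ Q → ∀ j ≤ k₀, (∀ i < j, n i ≤ Q * (ρ⁻¹) ^ i) → lam j ≤ (cB0 + cB1 * Q) * (ρ⁻¹) ^ j + cA * ρ ^ j)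
    (hsmall : Real.exp (θ' * (ρ ^ 3 / (1 - ρ ^ 4))) * θ₂ * (1 + cB1) * (ρ ^ 3 / (1 - ρ ^ 4)) ≤ 1 / 2) :
    ∀ j ≤ k₀, n j ≤ (2 * Real.exp (θ' * (ρ ^ 3 / (1 - ρ ^ 4))) * θ₂ * ((M + cA) * (ρ ^ (2 * k₀ + 1) / (1 - ρ ^ 2)) + cB0 * (ρ ^ 3 / (1 - ρ ^ 4))))
      * (ρ⁻¹) ^ j := by
  -- letters
  have hρ2 : ρ ^ 2 < 1 := pow_lt_one₀ hρ0.le hρ1 (by norm_num)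
  have h12 : 0 < 1 - ρ ^ 2 := by linarith
  have hρ4 : ρ ^ 4 < 1 := pow_lt_one₀ hρ0.le hρ1 (by norm_num)
  have h14 : 0 < 1 - ρ ^ 4 := by linarith
  set E' : ℝ := Real.exp (θ' * (ρ ^ 3 / (1 - ρ ^ 4))) with hE'
  have hE'0 : 0 < E' := Real.exp_pos _
  set XA : ℝ := (M + cA) * (ρ ^ (2 * k₀ + 1) / (1 - ρ ^ 2)) with hXA
  set qB : ℝ := ρ ^ 3 / (1 - ρ ^ 4) with hqB
  have hXA0 : 0 ≤ XA := by positivity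
  have hqB0 : 0 ≤ qB := by positivity
  set Qn : ℝ := 2 * E' * θ₂ * (XA + cB0 * qB) with hQn
  have hQn0 : 0 ≤ Qn := by positivity
  -- strong induction
  intro j
  induction j using Nat.strong_induction_on with
  | _ j IH =>
    intro hj
    rcases Nat.eq_zero_or_pos j with rfl | hjpos
    · rw [hn0]; positivity
    -- the hypotheses below `j`
    have IH' : ∀ i < j, n i ≤ Qn * (ρ⁻¹) ^ i := fun i hi => IH i hi (by omega)
    -- unroll the line up to `j`
    have hunroll := sourced_recursion_bound_init hρ0 zero_le_one κ' n (fun i => σ i * (m i + n i + lam i)) hκ' hn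
      (fun i => by have := hσ i; have := hm0 i; have := hn i; have := hlam i; positivity) j
      (fun i hi => by have := hrec i (by omega); simpa using this)
    rw [hn0, mul_zero, zero_add] at hunroll
    -- the exponential factor
    have hexp : Real.exp (1 / ρ * ∑ i ∈ Finset.range j, κ' i) ≤ E' := by
      have hsum : ∑ i ∈ Finset.range j, κ' i ≤ θ' * (ρ ^ 4 / (1 - ρ ^ 4)) := by
        calc ∑ i ∈ Finset.range j, κ' i ≤ ∑ i ∈ Finset.range j, θ' * ρ ^ (4 * (k₀ - i)) :=
              Finset.sum_le_sum fun i hi => hκ'geo i (by have := Finset.mem_range.mp hi; omega)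
          _ = θ' * ∑ i ∈ Finset.range j, ρ ^ (4 * (k₀ - i)) := by rw [Finset.mul_sum]
          _ ≤ θ' * (ρ ^ 4 / (1 - ρ ^ 4)) := mul_le_mul_of_nonneg_left (geom_sum_top_le hρ0.le hρ1 hj) hθ'
      rw [hE']
      apply Real.exp_le_exp.mpr
      calc 1 / ρ * ∑ i ∈ Finset.range j, κ' i ≤ 1 / ρ * (θ' * (ρ ^ 4 / (1 - ρ ^ 4))) := mul_le_mul_of_nonneg_left hsum (by positivity)
        _ = θ' * (ρ ^ 3 / (1 - ρ ^ 4)) := by field_simp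
    -- the fed source, term by term
    have hterm : ∀ i ∈ Finset.range j, ρ ^ (j - 1 - i) * (σ i * (m i + n i + lam i))
        ≤ θ₂ * ((M + cA) * (ρ ^ (j - 1 - i) * ρ ^ (2 * (k₀ - i)) * ρ ^ i)
            + (Qn * (1 + cB1) + cB0) * (ρ ^ (j - 1 - i) * ρ ^ (2 * (k₀ - i)) * (ρ⁻¹) ^ i)) := by
      intro i hi
      have hij : i < j := Finset.mem_range.mp hi
      have hik : i ≤ k₀ := by omega
      have hni := IH' i hij
      have hmi := hm i hik
      have hli := hfb Qn hQn0 i hik (fun i' hi' => IH' i' (hi'.trans hij))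
      have hσi := hσgeo i (by omega)
      have hp0 : 0 ≤ ρ ^ (j - 1 - i) := pow_nonneg hρ0.le _
      have hsrc : m i + n i + lam i ≤ (M + cA) * ρ ^ i + (Qn * (1 + cB1) + cB0) * (ρ⁻¹) ^ i := by nlinarith
      have hsrc0 : 0 ≤ m i + n i + lam i := by have := hm0 i; have := hn i; have := hlam i; positivity
      calc ρ ^ (j - 1 - i) * (σ i * (m i + n i + lam i))
          ≤ ρ ^ (j - 1 - i) * ((θ₂ * ρ ^ (2 * (k₀ - i))) * ((M + cA) * ρ ^ i + (Qn * (1 + cB1) + cB0) * (ρ⁻¹) ^ i)) :=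
            mul_le_mul_of_nonneg_left (mul_le_mul hσi hsrc hsrc0 (by positivity)) hp0
        _ = _ := by ring
    have hsum_le : ∑ i ∈ Finset.range j, ρ ^ (j - 1 - i) * (σ i * (m i + n i + lam i))
        ≤ θ₂ * ((M + cA) * ((ρ⁻¹) ^ j * (ρ ^ (2 * k₀ + 1) / (1 - ρ ^ 2))) + (Qn * (1 + cB1) + cB0) * ((ρ⁻¹) ^ j * qB)) := by
      refine (Finset.sum_le_sum hterm).trans ?_
      rw [← Finset.mul_sum, Finset.sum_add_distrib, ← Finset.mul_sum, ← Finset.mul_sum]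
      have hA := sum_source_A_le hρ0 hρ1 hj
      have hB := sum_source_B_le hρ0 hρ1 hj
      have h1 : 0 ≤ M + cA := by positivity
      have h2 : 0 ≤ Qn * (1 + cB1) + cB0 := by positivity
      exact mul_le_mul_of_nonneg_left (add_le_add (mul_le_mul_of_nonneg_left hA h1) (mul_le_mul_of_nonneg_left hB h2)) hθ₂
    have hS0 : 0 ≤ ∑ i ∈ Finset.range j, ρ ^ (j - 1 - i) * (σ i * (m i + n i + lam i)) :=
      Finset.sum_nonneg fun i _ => by have := hσ i; have := hm0 i; have := hn i; have := hlam i; positivity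
    -- assemble: `n j ≤ E′·θ₂·(XA + (Qn(1+cB1) + cB0)·qB)·(ρ⁻¹)^j ≤ Qn·(ρ⁻¹)^j`
    have hρj : 0 ≤ (ρ⁻¹) ^ j := pow_nonneg (inv_nonneg.mpr hρ0.le) _
    have hstep : n j ≤ E' * (θ₂ * ((M + cA) * ((ρ⁻¹) ^ j * (ρ ^ (2 * k₀ + 1) / (1 - ρ ^ 2))) + (Qn * (1 + cB1) + cB0) * ((ρ⁻¹) ^ j * qB))) :=
      hunroll.trans (mul_le_mul hexp hsum_le hS0 hE'0.le)
    have hkey : E' * (θ₂ * ((M + cA) * ((ρ⁻¹) ^ j * (ρ ^ (2 * k₀ + 1) / (1 - ρ ^ 2))) + (Qn * (1 + cB1) + cB0) * ((ρ⁻¹) ^ j * qB)))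
        = (E' * θ₂ * (XA + cB0 * qB) + (E' * θ₂ * (1 + cB1) * qB) * Qn) * (ρ⁻¹) ^ j := by
      rw [hXA]; ring
    rw [hkey] at hstep
    have habs : (E' * θ₂ * (1 + cB1) * qB) * Qn ≤ (1 / 2) * Qn := mul_le_mul_of_nonneg_right hsmall hQn0
    have hfin : E' * θ₂ * (XA + cB0 * qB) + (E' * θ₂ * (1 + cB1) * qB) * Qn ≤ Qn := by
      have : E' * θ₂ * (XA + cB0 * qB) = (1 / 2) * Qn := by rw [hQn]; ring
      linarith
    exact hstep.trans (mul_le_mul_of_nonneg_right hfin hρj)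

end Summit.QuantumFields.YangMills.Theorems.Prop7CornerCombCoupledClosure

end
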